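import Summits.CriticalPhenomena.PercolationContinuityZ3.Theses.PercSubharmonicSquare

/-!
# Birth skeleton (BC3) for the piece `RingDispersion` — child 2 of the deciding crux
# `SubharmonicPower` (stmt-CriticalPhenomena-11505), route `PercSubharmonicSquare`

Piece (route child, strategist split 2026-08-17):
`RingDispersion := ∃ B > 0, R, ∀ p < p_c(ℤ³), ∀ ‖x‖ > R, (1 + B/‖x‖²) m_p(x)² ≤ (1/6) Σ_{y ∼ x} τ_p(0,y)²`
— the relative variance of `τ_p(0,·)` over the six-neighbour ring of a far site is `≥ B/‖x‖²`.

## The cut: an UNDIRECTED OSCILLATION FLOOR in antipodal currency, plus the massive regime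

* `stub_oscillationFloor` (critical window, the engine; `∀ δ > 0, ∃ β > 0, R`): whenever
  `τ_p(0,x)·‖x‖ > δ`, the three ANTIPODAL differences are not all small:
  `(β/‖x‖)² m² ≤ Σ_i (τ(x+e_i) - τ(x-e_i))²` (for a radial profile `r^{-a}` the antipodal difference
  along the major axis `|x_i| = ‖x‖∞` is `≈ 2a x_i/r² · τ ≥ (2a/√3)(τ/r)`).
  Undirected: it asserts that `τ_p` has no flat ring (no plateau, no lattice saddle with vanishing
  antipodal differences) but gives no decay — it does not iterate to a bound on `τ`. The directed
  version ("`τ` decreases radially at rate `β/r`") WOULD iterate to uniform polynomial decay, i.e. to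
  the summit, and is deliberately not used.
* `stub_massiveDispersion` (`∃ δ > 0, B, R`): in the massive regime `τ_p(0,x)·‖x‖ ≤ δ` the ring
  variance floor holds (Ornstein–Zernike: neighbour ratios `≈ e^{±x_i/(rξ)}`, relative variance
  `≈ 1/(3ξ²) ≥ B/r²` once `r ≥ √(3B) ξ`, which `τ r ≤ δ` enforces up to a logarithm; `p → 0`: ratios
  of order `p`).

Composition `RingDispersion_of` (real proof): antipodal squared differences are dominated by the ring
variance, `Σ_i (u_i - v_i)² ≤ 2 Σ_i [(u_i - m)² + (v_i - m)²]`, and `Σ (τ - m)² = Σ τ² - 6 m²`; so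
stub 1 gives the piece in the window with `B = β²/12`, stub 2 in the massive regime, and
`B := min (β²/12) B₂`, `R := max R₁ R₂`.

Disproof used: none exists for this crux; negatives index: nothing on connectivity oscillation.
Nearest literature: axial monotonicity of `τ_p(0,·)` is known only for `p` near `0`
(de Lima–Procacci–Sanchis, J. Stat. Phys. 160 (2015), doi:10.1007/s10955-015-1284-z) — the
oscillation floor is a quantitative, undirected cousin of that open monotonicity question.
-/

namespace Summit.CriticalPhenomena.PercolationContinuityZ3.Cruxes.SubharmonicPower.RingDispersionBirth

open Literature.Probability.Percolation Literature.Probability.LatticeModels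

/-- The piece, by value (route decl `PercSubharmonicSquare.RingDispersion` once the split is applied). -/
def RingDispersion : Prop :=
  ∃ (B : ℝ) (R : ℕ), 0 < B ∧ ∀ p : unitInterval, (p : ℝ) < Literature.Probability.Percolation.criticalProb (Literature.Probability.LatticeModels.zdGraph 3) (0 : Literature.Probability.LatticeModels.Site 3) → ∀ x : Literature.Probability.LatticeModels.Site 3, (R : ℝ) < ‖x‖ → (1 + B / ‖x‖ ^ 2) * ((1 / 6 : ℝ) * ∑ i : Fin 3, (Literature.Probability.Percolation.tau 3 p 0 (x + Pi.single i 1) + Literature.Probability.Percolation.tau 3 p 0 (x - Pi.single i 1))) ^ 2 ≤ (1 / 6 : ℝ) * ∑ i : Fin 3, (Literature.Probability.Percolation.tau 3 p 0 (x + Pi.single i 1) ^ 2 + Literature.Probability.Percolation.tau 3 p 0 (x - Pi.single i 1) ^ 2)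

/-- **Stub 1 (antipodal oscillation floor in the critical window; the engine).** For every `δ > 0`
there are `β > 0` and `R` such that for `p < p_c(ℤ³)`, `‖x‖ > R` and `τ_p(0,x)·‖x‖ > δ`, the three
antipodal differences are not all small: `(β/‖x‖)² m_p(x)² ≤ Σ_i (τ_p(0,x+e_i) - τ_p(0,x-e_i))²`.
Why plausibly true: along the major axis `|x_i| = ‖x‖∞` a profile `r^{-a} g(r/ξ)` with `g` decreasing
has antipodal difference `≥ (2a/√3) τ/r`, `a = 1+η ≈ 0.95 > 0`. Why it might fail: it is the
"no plateau" content (false at `r ≪ ξ'` in a jump world); even under continuity, lattice saddles of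
`τ_p` are not excluded by any known inequality. Size: XL. -/
theorem stub_oscillationFloor :
    ∀ δ : ℝ, 0 < δ → ∃ (β : ℝ) (R : ℕ), 0 < β ∧ ∀ p : unitInterval,
      (p : ℝ) < criticalProb (zdGraph 3) (0 : Site 3) → ∀ x : Site 3, (R : ℝ) < ‖x‖ →
        δ < tau 3 p 0 x * ‖x‖ →
        (β / ‖x‖) ^ 2 * ((1 / 6 : ℝ) * ∑ i : Fin 3,
          (tau 3 p 0 (x + Pi.single i 1) + tau 3 p 0 (x - Pi.single i 1))) ^ 2 ≤
        ∑ i : Fin 3, (tau 3 p 0 (x + Pi.single i 1) - tau 3 p 0 (x - Pi.single i 1)) ^ 2 := by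
  sorry

/-- **Stub 2 (ring dispersion in the massive regime).** There are `δ > 0`, `B > 0`, `R` such that for
`p < p_c(ℤ³)`, `‖x‖ > R` and `τ_p(0,x)·‖x‖ ≤ δ`, the ring variance floor
`(1 + B/‖x‖²) m_p(x)² ≤ (1/6) Σ_{y ∼ x} τ_p(0,y)²` holds. Why plausibly true: Ornstein–Zernike ratios
`τ(x ∓ e_i)/τ(x) ≈ e^{±x_i/(rξ)}` give relative variance `≈ 1/(3ξ(p)²) ≫ 1/r²` for `r ≳ ξ log(1/δ)`;
`p = 0` is `0 ≤ 0`. Needs uniform-in-`p` OZ lower AND upper bounds on neighbour ratios. Size: L. -/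
theorem stub_massiveDispersion :
    ∃ (δ : ℝ) (B : ℝ) (R : ℕ), 0 < δ ∧ 0 < B ∧ ∀ p : unitInterval,
      (p : ℝ) < criticalProb (zdGraph 3) (0 : Site 3) → ∀ x : Site 3, (R : ℝ) < ‖x‖ →
        tau 3 p 0 x * ‖x‖ ≤ δ →
        (1 + B / ‖x‖ ^ 2) * ((1 / 6 : ℝ) * ∑ i : Fin 3,
          (tau 3 p 0 (x + Pi.single i 1) + tau 3 p 0 (x - Pi.single i 1))) ^ 2 ≤
        (1 / 6 : ℝ) * ∑ i : Fin 3,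
          (tau 3 p 0 (x + Pi.single i 1) ^ 2 + tau 3 p 0 (x - Pi.single i 1) ^ 2) := by
  sorry

/-- Antipodal squared differences are dominated by twice the squared deviations from any centre `m`:
`Σ_i (u_i - v_i)² ≤ 2 Σ_i ((u_i - m)² + (v_i - m)²)`. [folklore] -/
theorem sum_sq_sub_le (u v : Fin 3 → ℝ) (m : ℝ) :
    ∑ i, (u i - v i) ^ 2 ≤ 2 * ∑ i, ((u i - m) ^ 2 + (v i - m) ^ 2) := by
  rw [Finset.mul_sum]
  refine Finset.sum_le_sum fun i _ => ?_
  nlinarith [sq_nonneg (u i + v i - 2 * m)]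

/-- The variance identity on the ring: `Σ_i ((u_i - m)² + (v_i - m)²) = Σ_i (u_i² + v_i²) - 6 m²`
when `m` is the mean `(1/6) Σ_i (u_i + v_i)`. [folklore] -/
theorem sum_sq_dev_eq (u v : Fin 3 → ℝ) (m : ℝ) (hm : m = (1 / 6 : ℝ) * ∑ i, (u i + v i)) :
    ∑ i, ((u i - m) ^ 2 + (v i - m) ^ 2) = ∑ i, (u i ^ 2 + v i ^ 2) - 6 * m ^ 2 := by
  have hsum : ∑ i, (u i + v i) = 6 * m := by rw [hm]; ring
  have : ∑ i, ((u i - m) ^ 2 + (v i - m) ^ 2)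
      = ∑ i, (u i ^ 2 + v i ^ 2) - 2 * m * ∑ i, (u i + v i) + ∑ _i : Fin 3, 2 * m ^ 2 := by
    rw [Finset.mul_sum, ← Finset.sum_sub_distrib, ← Finset.sum_add_distrib]
    exact Finset.sum_congr rfl fun i _ => by ring
  rw [this, hsum, Finset.sum_const, Finset.card_univ, Fintype.card_fin]
  simp only [nsmul_eq_mul, Nat.cast_ofNat]
  ring

/-- **Composition (real proof).** In the window, stub 1 and the two identities above give the
variance floor with `B = β²/12`; in the massive regime stub 2 gives it with `B₂`; take
`B := min (β²/12) B₂`, `R := max R₁ R₂`. [folklore] -/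
theorem RingDispersion_of
    (h1 : ∀ δ : ℝ, 0 < δ → ∃ (β : ℝ) (R : ℕ), 0 < β ∧ ∀ p : unitInterval,
      (p : ℝ) < criticalProb (zdGraph 3) (0 : Site 3) → ∀ x : Site 3, (R : ℝ) < ‖x‖ →
        δ < tau 3 p 0 x * ‖x‖ →
        (β / ‖x‖) ^ 2 * ((1 / 6 : ℝ) * ∑ i : Fin 3,
          (tau 3 p 0 (x + Pi.single i 1) + tau 3 p 0 (x - Pi.single i 1))) ^ 2 ≤
        ∑ i : Fin 3, (tau 3 p 0 (x + Pi.single i 1) - tau 3 p 0 (x - Pi.single i 1)) ^ 2)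
    (h2 : ∃ (δ : ℝ) (B : ℝ) (R : ℕ), 0 < δ ∧ 0 < B ∧ ∀ p : unitInterval,
      (p : ℝ) < criticalProb (zdGraph 3) (0 : Site 3) → ∀ x : Site 3, (R : ℝ) < ‖x‖ →
        tau 3 p 0 x * ‖x‖ ≤ δ →
        (1 + B / ‖x‖ ^ 2) * ((1 / 6 : ℝ) * ∑ i : Fin 3,
          (tau 3 p 0 (x + Pi.single i 1) + tau 3 p 0 (x - Pi.single i 1))) ^ 2 ≤
        (1 / 6 : ℝ) * ∑ i : Fin 3,
          (tau 3 p 0 (x + Pi.single i 1) ^ 2 + tau 3 p 0 (x - Pi.single i 1) ^ 2)) :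
    RingDispersion := by
  obtain ⟨δ, B₂, R₂, hδ, hB₂, H2⟩ := h2
  obtain ⟨β, R₁, hβ, H1⟩ := h1 δ hδ
  refine ⟨min (β ^ 2 / 12) B₂, max R₁ R₂, lt_min (by positivity) hB₂, ?_⟩
  intro p hp x hx
  push_cast at hx
  obtain ⟨hx1, hx2⟩ := max_lt_iff.mp hx
  set u : Fin 3 → ℝ := fun i => tau 3 p 0 (x + Pi.single i 1) with hu
  set v : Fin 3 → ℝ := fun i => tau 3 p 0 (x - Pi.single i 1) with hv
  set m : ℝ := (1 / 6 : ℝ) * ∑ i, (u i + v i) with hm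
  have hm2 : 0 ≤ m ^ 2 := sq_nonneg m
  show (1 + min (β ^ 2 / 12) B₂ / ‖x‖ ^ 2) * m ^ 2 ≤ (1 / 6 : ℝ) * ∑ i, (u i ^ 2 + v i ^ 2)
  rcases le_or_gt (tau 3 p 0 x * ‖x‖) δ with hle | hlt
  · -- massive regime: stub 2, and monotonicity of the left side in `B`
    have h := H2 p hp x hx2 hle
    have hmono : (1 + min (β ^ 2 / 12) B₂ / ‖x‖ ^ 2) * m ^ 2 ≤ (1 + B₂ / ‖x‖ ^ 2) * m ^ 2 := by
      apply mul_le_mul_of_nonneg_right _ hm2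
      have : min (β ^ 2 / 12) B₂ / ‖x‖ ^ 2 ≤ B₂ / ‖x‖ ^ 2 :=
        div_le_div_of_nonneg_right (min_le_right _ _) (sq_nonneg _)
      linarith
    exact hmono.trans h
  · -- critical window: stub 1 + the two ring identities
    have h := H1 p hp x hx1 hlt
    change (β / ‖x‖) ^ 2 * m ^ 2 ≤ ∑ i, (u i - v i) ^ 2 at h
    have hdom := sum_sq_sub_le u v m
    have hid := sum_sq_dev_eq u v m hm
    have hmono : (1 + min (β ^ 2 / 12) B₂ / ‖x‖ ^ 2) * m ^ 2 ≤
        (1 + (β ^ 2 / 12) / ‖x‖ ^ 2) * m ^ 2 := by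
      apply mul_le_mul_of_nonneg_right _ hm2
      have : min (β ^ 2 / 12) B₂ / ‖x‖ ^ 2 ≤ (β ^ 2 / 12) / ‖x‖ ^ 2 :=
        div_le_div_of_nonneg_right (min_le_left _ _) (sq_nonneg _)
      linarith
    refine hmono.trans ?_
    have hβx : (β / ‖x‖) ^ 2 = β ^ 2 / ‖x‖ ^ 2 := by rw [div_pow]
    rw [hβx] at h
    -- `(β²/r²) m² ≤ Σ (u-v)² ≤ 2 (Σ (u²+v²) - 6 m²)`
    have key : β ^ 2 / ‖x‖ ^ 2 * m ^ 2 ≤ 2 * (∑ i, (u i ^ 2 + v i ^ 2) - 6 * m ^ 2) := by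
      rw [← hid]; exact h.trans hdom
    have : (1 + (β ^ 2 / 12) / ‖x‖ ^ 2) * m ^ 2 = m ^ 2 + (1 / 12) * (β ^ 2 / ‖x‖ ^ 2 * m ^ 2) := by
      ring
    rw [this]
    linarith

end Summit.CriticalPhenomena.PercolationContinuityZ3.Cruxes.SubharmonicPower.RingDispersionBirth
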